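import Literature.MathematicalPhysics.QuantumManyBody.EliashbergTcCeiling

/-!
# The Matsubara cutoff: at fixed pseudopotential `μ_N`, the Eliashberg `T_c` is non-decreasing in `N`

Companion to `EliashbergTcCeiling` / `EliashbergTcMonotonicity`. The conventional-branch engines
(`pub/hubbard-eph`) print the linearised isotropic Migdal–Eliashberg `T_c` at several cutoff
multiples `ω_c = k ω_max`, `k ∈ {5, 10, 20}` (the «k-box»). Under the «cut» convention (c1: the number
`μ*` is used directly as the cutoff pseudopotential `μ_N`, no rescaling) and the full-line
mass-renormalisation weights `d_n = 2n+1 + λ(0) + 2Σ_{k≤n} λ(k)` — which do not depend on the cutoff —,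
the kernel on `N` frequencies is the LEADING PRINCIPAL SUBMATRIX of the kernel on `N' ≥ N` frequencies:
`K^{(N)}_{nm} = (λ(|n−m|) + λ(n+m+1) − 2μ)/(d_n d_m)^{1/2}` for `n, m < N` whatever `N`. Cauchy's
interlacing theorem [cite: HornJohnson2013, Thm. 4.3.28] then gives `λ_max(K^{(N)}) ≤ λ_max(K^{(N')})`
at every temperature: enlarging the cutoff can only RAISE the top eigenvalue, hence only raise
`T_c = sSup {T > 0 | 1 ≤ ρ(T)}` (the larger variational space lets the high-frequency gap take the
opposite sign and exploit the repulsion — the mechanism behind the Morel–Anderson renormalisation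
`μ → μ* = μ/(1 + μ ln(E/ω))` [cite: AllenDynes1975, §III]; this is also the finite-rank half of the
variational characterisation in [cite: KiesslingAltshulerYuzbashyan2025II, Thm. 4]). Under the cell's
convention of record c2′ the cutoff pseudopotential is rescaled with `k` and no sign is asserted.

* `eigenvalues₀_max_submatrix_le` — `λ_max(A[κ,κ]) ≤ λ_max(A)` (the top case of
  `KyFan.eigenvalues₀_submatrix_le`);
* `eigenvalues₀_max_mono_cutoff` — for two kernels built from the same `λ(·)`, `d`, `μ` on `Fin N` and
  `Fin N'`, `N ≤ N'`, the top eigenvalue on `N` is `≤` the one on `N'`;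
* `sSup_superlevel_mono_of_le` — threshold form: pointwise `ρ₁ ≤ ρ₂` and `BddAbove` of the larger
  super-level set (now a theorem, `EliashbergTcCeiling`) give `T_c[ρ₁] ≤ T_c[ρ₂]`.

## References
* [HornJohnson2013] R. A. Horn, C. R. Johnson, *Matrix Analysis*, 2nd ed., CUP 2013 — Thm. 4.3.28.
* [AllenDynes1975] P. B. Allen, R. C. Dynes, Phys. Rev. B 12 (1975) 905 — Eqs. (9)–(12), §III.
* [KiesslingAltshulerYuzbashyan2025II] M. K.-H. Kiessling, B. L. Altshuler, E. A. Yuzbashyan, J. Stat.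
  Phys. 192 (2025), doi:10.1007/s10955-025-03468-z — Thm. 4.
-/

noncomputable section

open scoped Matrix

namespace Literature.MathematicalPhysics.QuantumManyBody

open Finset _root_.Matrix Literature.Analysis.Matrix Real

/-- **Top eigenvalue of a principal submatrix.** For a real symmetric `A` and an embedding
`f : κ ↪ ι` with `κ` nonempty, `λ_max(A[κ,κ]) ≤ λ_max(A)`. [cite: HornJohnson2013, Thm. 4.3.28] -/
theorem eigenvalues₀_max_submatrix_le {ι κ : Type*} [Fintype ι] [DecidableEq ι] [Fintype κ]
    [DecidableEq κ] {A : Matrix ι ι ℝ} (hA : A.IsHermitian) (f : κ ↪ ι)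
    (hB : (A.submatrix f f).IsHermitian) (hκ : 1 ≤ Fintype.card κ) (hι : 1 ≤ Fintype.card ι) :
    hB.eigenvalues₀ (Fin.castLE hκ 0) ≤ hA.eigenvalues₀ (Fin.castLE hι 0) := by
  have h := KyFan.eigenvalues₀_submatrix_le hA f hB (Fin.castLE hκ 0)
  have e : Fin.castLE (Fintype.card_le_of_embedding f) (Fin.castLE hκ 0) = Fin.castLE hι 0 := by
    ext; simp
  rw [e] at h
  exact h

/-- **The Eliashberg kernel at fixed `μ_N` is monotone in the cutoff.** Two symmetrised kernels
`K = (Λ_{nm} − 2μ)/(d_n d_m)^{1/2}` on `Fin N` and `Fin N'`, `N ≤ N'`, built from the SAME coupling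
sequence `λ(·)`, weights `d` (functions of the frequency index only — the full-line `Z` convention) and
pseudopotential `μ` (in the tree's vocabulary `rankOneDownshift S₀ s μ` with `S₀ = Λ/(d d)^{1/2}`,
`s = d^{-1/2}`): the top eigenvalue on `N` frequencies is `≤` the one on `N'`.
[cite: HornJohnson2013, Thm. 4.3.28] -/
theorem eigenvalues₀_max_mono_cutoff {N N' : ℕ} (hNN : N ≤ N') (lam : ℕ → ℝ) (d : ℕ → ℝ) (μ : ℝ)
    (S₀ : Matrix (Fin N) (Fin N) ℝ) (hS₀ : S₀.IsHermitian)
    (hS : ∀ n m : Fin N, S₀ n m =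
      (lam (Nat.dist n m) + lam ((n : ℕ) + m + 1)) / (Real.sqrt (d n) * Real.sqrt (d m)))
    (S₀' : Matrix (Fin N') (Fin N') ℝ) (hS₀' : S₀'.IsHermitian)
    (hS' : ∀ n m : Fin N', S₀' n m =
      (lam (Nat.dist n m) + lam ((n : ℕ) + m + 1)) / (Real.sqrt (d n) * Real.sqrt (d m)))
    (s : Fin N → ℝ) (hs : ∀ n : Fin N, s n = 1 / Real.sqrt (d n))
    (s' : Fin N' → ℝ) (hs' : ∀ n : Fin N', s' n = 1 / Real.sqrt (d n))
    (hn : 1 ≤ Fintype.card (Fin N)) (hn' : 1 ≤ Fintype.card (Fin N')) :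
    (isHermitian_rankOneDownshift hS₀ s μ).eigenvalues₀ (Fin.castLE hn 0) ≤
      (isHermitian_rankOneDownshift hS₀' s' μ).eigenvalues₀ (Fin.castLE hn' 0) := by
  set f : Fin N ↪ Fin N' := Fin.castLEEmb hNN with hf
  -- the small kernel is the principal submatrix of the large one along `f`
  have hsub : (rankOneDownshift S₀' s' μ).submatrix f f = rankOneDownshift S₀ s μ := by
    ext n m
    simp only [Matrix.submatrix_apply, rankOneDownshift, Matrix.sub_apply, Matrix.smul_apply,
      vecMulVec_apply, smul_eq_mul, hS, hS', hs, hs', hf, Fin.castLEEmb_apply, Fin.val_castLE]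
  have hB : ((rankOneDownshift S₀' s' μ).submatrix f f).IsHermitian := by
    rw [hsub]; exact isHermitian_rankOneDownshift hS₀ s μ
  have h := eigenvalues₀_max_submatrix_le (isHermitian_rankOneDownshift hS₀' s' μ) f hB hn hn'
  have e : hB.eigenvalues₀ = (isHermitian_rankOneDownshift hS₀ s μ).eigenvalues₀ := by
    congr 1
  rw [e] at h
  exact h

/-- **Threshold form.** If `ρ₁ ≤ ρ₂` pointwise (the top eigenvalue at the smaller cutoff vs the
larger, at every temperature) and the super-level set of `ρ₂` is bounded above (a theorem for the
Eliashberg kernel: `EliashbergTcCeiling.sSup_superlevel_le_of_lt_one`), then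
`T_c[ρ₁] = sSup {T > 0 | 1 ≤ ρ₁ T} ≤ T_c[ρ₂]`. [cite: AllenDynes1975, §III] -/
theorem sSup_superlevel_mono_of_le {ρ₁ ρ₂ : ℝ → ℝ} (hρ : ∀ T, ρ₁ T ≤ ρ₂ T)
    (hbdd : BddAbove {T : ℝ | 0 < T ∧ 1 ≤ ρ₂ T}) :
    sSup {T : ℝ | 0 < T ∧ 1 ≤ ρ₁ T} ≤ sSup {T : ℝ | 0 < T ∧ 1 ≤ ρ₂ T} :=
  sSup_superlevel_antitone (ρ := fun i T => if i = 0 then ρ₂ T else ρ₁ T) (μ₁ := 0) (μ₂ := 1)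
    (fun T => by simpa using hρ T) (by simpa using hbdd) |> fun h => by simpa using h

end Literature.MathematicalPhysics.QuantumManyBody
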